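import Summits.HubbardSuperconductivity.HubbardSuperconductivity.Theorems.AnisotropyChordSpinMonotoneCompleteGraph
import Summits.HubbardSuperconductivity.HubbardSuperconductivity.Theorems.AnisotropyChordTwoMagnonCoordinates
import Literature.MathematicalPhysics.QuantumLattice.LiebMattisLadder

/-!
# Route `AnisotropyChord`: `U_vt` on the complete graph `K_n`, literally (all sectors, `Δ₁ ≤ Δ₂ ≤ 1`)

Complement to `…SpinMonotoneCompleteGraph` (strict `Δ₁ < Δ₂`): on `K_n` the Ising part
`H(1) − H(0) = −Σ_{E(K_n)} Sᶻ_x Sᶻ_y` acts on the sector `Sᶻ_tot = M` as the scalar `−(M² − |V|/4)/2`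
(`completeGraph_isingPart_mulVec`), so two normalised sector ground states at the SAME anisotropy have
the same `Re⟨ψ, H(1)ψ⟩ = E_M(Δ) + (1−Δ)·scalar`, hence the same `⟨𝐒²⟩` and the same condensate
(`completeGraph_condensate_eq_of_sameΔ`); with the strict case this gives the `K_n` slice of
`…SpinMonotoneDefs.VertexTransitiveCondensateMonotone` verbatim (`completeGraph_condensate_slice`).
No Perron–Frobenius / uniqueness is used.  No definition is introduced.
-/

set_option linter.dupNamespace false

noncomputable section

namespace Summit.HubbardSuperconductivity.HubbardSuperconductivity.Theorems.AnisotropyChord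

open Matrix Complex Finset
open Literature.MathematicalPhysics.QuantumLattice

variable {V : Type*} [Fintype V] [DecidableEq V]

/-- On `K_n` the Ising weight of a configuration of magnetisation `M` is `(M² − |V|/4)/2`:
`Σ_{e ∈ E(K_n)} (½ − σ_x)(½ − σ_y) = ((Σ_x (½ − σ_x))² − |V|/4)/2`. [folklore] -/
theorem completeGraph_isingWeight (σ : V → Fin 2) :
    (∑ e ∈ (⊤ : SimpleGraph V).edgeFinset,
        Sym2.lift ⟨fun x y => ((1 : ℝ) / 2 - (σ x : ℕ)) * ((1 : ℝ) / 2 - (σ y : ℕ)),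
          fun _ _ => mul_comm _ _⟩ e : ℝ)
      = ((∑ x, ((1 : ℝ) / 2 - (σ x : ℕ))) ^ 2 - (Fintype.card V : ℝ) / 4) / 2 := by
  rw [TwoMagnon.sum_edgeFinset_lift_eq_half]
  have hsq : ∀ x : V, ((1 : ℝ) / 2 - (σ x : ℕ)) * ((1 : ℝ) / 2 - (σ x : ℕ)) = 1 / 4 := by
    intro x
    have h01 : σ x = 0 ∨ σ x = 1 := by
      rcases Fin.eq_zero_or_eq_succ (σ x) with h | ⟨j, hj⟩
      · exact Or.inl h
      · exact Or.inr (by rw [hj]; exact congrArg Fin.succ (Fin.eq_zero j))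
    rcases h01 with h | h <;> simp [h] <;> norm_num
  have hsplit : ∀ x y : V, (if (⊤ : SimpleGraph V).Adj x y then
      ((1 : ℝ) / 2 - (σ x : ℕ)) * ((1 : ℝ) / 2 - (σ y : ℕ)) else 0)
        = ((1 : ℝ) / 2 - (σ x : ℕ)) * ((1 : ℝ) / 2 - (σ y : ℕ))
          - (if x = y then (1 : ℝ) / 4 else 0) := by
    intro x y
    by_cases h : x = y
    · subst h
      rw [if_neg ((SimpleGraph.top_adj x x).not.mpr (not_not.mpr rfl)), if_pos rfl, hsq, sub_self]
    · rw [if_pos ((SimpleGraph.top_adj x y).mpr h), if_neg h, sub_zero]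
  have hdiag : ∑ x : V, ∑ y : V, (if x = y then (1 : ℝ) / 4 else 0) = (Fintype.card V : ℝ) / 4 := by
    rw [show (Fintype.card V : ℝ) / 4 = ∑ _x : V, (1 : ℝ) / 4 by
      rw [Finset.sum_const, Finset.card_univ, nsmul_eq_mul]; ring]
    exact Finset.sum_congr rfl fun x _ => by rw [Finset.sum_ite_eq]; simp
  set S := ∑ x, ((1 : ℝ) / 2 - (σ x : ℕ)) with hS
  simp_rw [hsplit, Finset.sum_sub_distrib]
  rw [← Finset.sum_mul_sum, ← hS, hdiag, sq]
  ring

/-- **The Ising part is a scalar on each sector of `K_n`**: for `ψ ∈ 𝓗_M`,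
`(H(1) − H(0))ψ = −((M² − |V|/4)/2)·ψ`, `H(Δ) = xxzHamiltonian 1 ⊤ (−1) Δ`. [folklore] -/
theorem completeGraph_isingPart_mulVec {M : ℝ} {ψ : (V → Fin 2) → ℂ}
    (hψ : ψ ∈ spinZSector (Λ := V) 1 M) :
    ((xxzHamiltonian 1 (⊤ : SimpleGraph V) (-1) 1 - xxzHamiltonian 1 (⊤ : SimpleGraph V) (-1) 0 :
        Op V 2) *ᵥ ψ) = ((-((M ^ 2 - (Fintype.card V : ℝ) / 4) / 2) : ℝ) : ℂ) • ψ := by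
  have hsec := (LiebMattis.mem_spinZSector_iff (Λ := V) 1 M ψ).mp hψ
  rw [OneMagnon.xxz_eq_neg_heisenberg_add_diagonal, OneMagnon.xxz_eq_neg_heisenberg_add_diagonal,
    add_sub_add_left_eq_sub, Matrix.diagonal_sub]
  funext σ
  rw [Matrix.mulVec_diagonal, Pi.smul_apply, smul_eq_mul]
  by_cases hz : ψ σ = 0
  · simp [hz]
  · have hM := hsec σ hz
    have hMre : (∑ x, ((1 : ℝ) / 2 - (σ x : ℕ))) = M := by
      have := congrArg Complex.re hM
      simpa [Complex.re_sum] using this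
    rw [completeGraph_isingWeight, hMre]
    push_cast
    ring

/-- **The isotropic energy of a sector ground state on `K_n` is determined by the sector energy**:
for a normalised sector ground state `ψ` of `H(Δ)`,
`Re⟨ψ, H(1)ψ⟩ = E_M(Δ) − (1−Δ)·(M² − |V|/4)/2`. [folklore] -/
theorem completeGraph_re_form_one_of_sectorGS {M Δ : ℝ} {ψ : (V → Fin 2) → ℂ}
    (gm : ψ ∈ spinZSector (Λ := V) 1 M) (gn : star ψ ⬝ᵥ ψ = 1)
    (ge : (xxzHamiltonian 1 (⊤ : SimpleGraph V) (-1) Δ : Op V 2) *ᵥ ψ =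
      ((lowestEnergyInSector 1 (xxzHamiltonian 1 (⊤ : SimpleGraph V) (-1) Δ) M : ℝ) : ℂ) • ψ) :
    (star ψ ⬝ᵥ ((xxzHamiltonian 1 (⊤ : SimpleGraph V) (-1) 1 : Op V 2) *ᵥ ψ)).re =
      lowestEnergyInSector 1 (xxzHamiltonian 1 (⊤ : SimpleGraph V) (-1) Δ) M
        - (1 - Δ) * ((M ^ 2 - (Fintype.card V : ℝ) / 4) / 2) := by
  have hΔ := re_form_affine 1 (⊤ : SimpleGraph V) (-1) Δ ψ
  have h1 := re_form_affine 1 (⊤ : SimpleGraph V) (-1) 1 ψ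
  have hE := re_form_of_sectorGS 1 (⊤ : SimpleGraph V) gn ge
  have hZ : (star ψ ⬝ᵥ ((xxzHamiltonian 1 (⊤ : SimpleGraph V) (-1) 1
      - xxzHamiltonian 1 (⊤ : SimpleGraph V) (-1) 0 : Op V 2) *ᵥ ψ)).re
        = -((M ^ 2 - (Fintype.card V : ℝ) / 4) / 2) := by
    rw [completeGraph_isingPart_mulVec gm, dotProduct_smul, gn, smul_eq_mul, mul_one, Complex.ofReal_re]
  rw [hZ] at hΔ h1
  rw [hE] at hΔ
  rw [h1]
  linarith

/-- **Same anisotropy, same condensate on `K_n`**: two normalised sector ground states of the same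
`H(Δ)` in the same sector have equal condensate (no uniqueness / Perron–Frobenius used:
`Λ = ⟨𝐒²⟩ − (M²−M) = (3/4)|V| − 2Re⟨ψ,H(1)ψ⟩ − (M²−M)` and `Re⟨ψ,H(1)ψ⟩` is determined by the
sector energy, `completeGraph_re_form_one_of_sectorGS`). [folklore] -/
theorem completeGraph_condensate_eq_of_same_anisotropy {M Δ : ℝ} {ψ₁ ψ₂ : (V → Fin 2) → ℂ}
    (g₁m : ψ₁ ∈ spinZSector (Λ := V) 1 M) (g₁n : star ψ₁ ⬝ᵥ ψ₁ = 1)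
    (g₁e : (xxzHamiltonian 1 (⊤ : SimpleGraph V) (-1) Δ : Op V 2) *ᵥ ψ₁ =
      ((lowestEnergyInSector 1 (xxzHamiltonian 1 (⊤ : SimpleGraph V) (-1) Δ) M : ℝ) : ℂ) • ψ₁)
    (g₂m : ψ₂ ∈ spinZSector (Λ := V) 1 M) (g₂n : star ψ₂ ⬝ᵥ ψ₂ = 1)
    (g₂e : (xxzHamiltonian 1 (⊤ : SimpleGraph V) (-1) Δ : Op V 2) *ᵥ ψ₂ =
      ((lowestEnergyInSector 1 (xxzHamiltonian 1 (⊤ : SimpleGraph V) (-1) Δ) M : ℝ) : ℂ) • ψ₂) :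
    (star ψ₁ ⬝ᵥ (((∑ x, onSite x (spinRaise 1)) * (∑ y, onSite y (spinLower 1)) : Op V 2) *ᵥ ψ₁)).re =
      (star ψ₂ ⬝ᵥ (((∑ x, onSite x (spinRaise 1)) * (∑ y, onSite y (spinLower 1)) : Op V 2) *ᵥ ψ₂)).re := by
  have s1 := completeGraph_re_totalSpinSq ψ₁
  have s2 := completeGraph_re_totalSpinSq ψ₂
  rw [completeGraph_re_form_one_of_sectorGS g₁m g₁n g₁e, g₁n,
    OneMagnon.re_totalSpinSq_eq_condensate_add g₁m, g₁n] at s1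
  rw [completeGraph_re_form_one_of_sectorGS g₂m g₂n g₂e, g₂n,
    OneMagnon.re_totalSpinSq_eq_condensate_add g₂m, g₂n] at s2
  simp only [Complex.one_re, mul_one] at s1 s2
  linarith

/-- **`U_vt` on the complete graph, verbatim** — the statement
`…SpinMonotoneDefs.VertexTransitiveCondensateMonotone` specialised to `G = ⊤` (any finite vertex
type, every sector, `−1 ≤ Δ₁ ≤ Δ₂ ≤ 1`; the lower bound is not used): strict case by Theorem V/VI
(`completeGraph_condensate_monotone`), equal case by `completeGraph_condensate_eq_of_same_anisotropy`.
[folklore] -/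
theorem completeGraph_condensate_slice (M Δ₁ Δ₂ : ℝ) (_h1 : -1 ≤ Δ₁) (h12 : Δ₁ ≤ Δ₂) (h2 : Δ₂ ≤ 1)
    (ψ₁ ψ₂ : (V → Fin 2) → ℂ)
    (g₁m : ψ₁ ∈ spinZSector (Λ := V) 1 M) (g₁n : star ψ₁ ⬝ᵥ ψ₁ = 1)
    (g₁e : (xxzHamiltonian 1 (⊤ : SimpleGraph V) (-1) Δ₁ : Op V 2) *ᵥ ψ₁ =
      ((lowestEnergyInSector 1 (xxzHamiltonian 1 (⊤ : SimpleGraph V) (-1) Δ₁) M : ℝ) : ℂ) • ψ₁)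
    (g₂m : ψ₂ ∈ spinZSector (Λ := V) 1 M) (g₂n : star ψ₂ ⬝ᵥ ψ₂ = 1)
    (g₂e : (xxzHamiltonian 1 (⊤ : SimpleGraph V) (-1) Δ₂ : Op V 2) *ᵥ ψ₂ =
      ((lowestEnergyInSector 1 (xxzHamiltonian 1 (⊤ : SimpleGraph V) (-1) Δ₂) M : ℝ) : ℂ) • ψ₂) :
    (star ψ₁ ⬝ᵥ (((∑ x, onSite x (spinRaise 1)) * (∑ y, onSite y (spinLower 1)) : Op V 2) *ᵥ ψ₁)).re ≤
      (star ψ₂ ⬝ᵥ (((∑ x, onSite x (spinRaise 1)) * (∑ y, onSite y (spinLower 1)) : Op V 2) *ᵥ ψ₂)).re := by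
  rcases lt_or_eq_of_le h12 with hlt | heq
  · exact completeGraph_condensate_monotone hlt h2 g₁m g₁n g₁e g₂m g₂n g₂e
  · subst heq
    exact (completeGraph_condensate_eq_of_same_anisotropy g₁m g₁n g₁e g₂m g₂n g₂e).le

end Summit.HubbardSuperconductivity.HubbardSuperconductivity.Theorems.AnisotropyChord
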